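import Summits.HodgeConjecture.HodgeConjecture.Theorems.MarkmanPartnerTransportRMTypeOrbitSymmetries
import HarnessLib

/-!
# Route MarkmanPartnerTransport · crux `PicardThreeK3Squares` (stmt-HodgeConjecture-19652) —
# «RATIONAL ORBIT DENSITY» 3/4: transitivity of real reflections on the Hodge locus `D_{θ,e}`

Cell hodge-nonav, crux #4 of route MarkmanPartnerTransport (HC⁴(S ⊗ S) for projective K3 surfaces with
ρ(S) ≥ 3; open core: real multiplication). Programme «RATIONAL ORBIT DENSITY» (prover seat
hodge-nonav-19652-p1, gen 10; `--supports stmt-HodgeConjecture-19652`, helper): the cell's moduli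
programme displays, per rational real-multiplication type `θ ∈ M₂₂(ℚ)` (`…RMTypeDefs`), the input
`RMTypeDominated θ` — an `RMSpreadFamily` at EVERY `θ`-eigen period, whose intended discharge needs the
universal family over the RM component plus Deligne's invariant-cycle theorem («moduli carriers do not
exist»). The programme replaces it by the WEAKER input «`θ` is cycle-induced at the marked K3 surfaces
whose periods lie in some non-empty OPEN subset of the Hodge locus `D_{θ,e}`», through the elementary
fact proved in this series: **the rational centraliser `G_θ(ℚ) = {g ∈ O(Λ_ℚ) : gθ = θg}` has dense
orbits on `D_{θ,e} = {y ∈ Λ_ℂ : θ_ℂ y = e y, (y.y) = 0, (ȳ.y) > 0}`**, while HC⁴ ∕ cycle-inducedness of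
`θ` is `G_θ(ℚ)`-invariant by Buskin transport (the pattern of `RMTypeDescent`, p620943).

THIS FILE (fact-free): Iversen's Prop. 2.3 with the reflecting vectors NAMED (`e − f`, `f`, `e + f`:
`exists_reflections_apply_eq_mem`, proof adapted from the tree's
`Literature.LinearAlgebra.QuadraticForm.exists_reflections_apply_eq`); real∕imaginary parts of vectors of
`Λ_ℂ`, reality of `θ_ℂ` and of reflections along real vectors; and the TRANSITIVITY statement
`exists_reflections_prod_eq_smul`: for two period points `y₀, y₁` of `D_{θ,e}` (`e` real) a word of at
most four reflections along non-isotropic REAL `e`-eigenvectors maps `y₀` to `r·y₁`, `r > 0` (frame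
transport `(Re y₀, Im y₀) ↦ r(Re y₁, Im y₁)`, the second step inside `(r Re y₁)^⊥`). No named fact, no
sorry; nothing here says HC is proved.

References: O'Meara, *Introduction to Quadratic Forms* (1963), §42–§43B (symmetries); Iversen,
*Hyperbolic Geometry* (1992), Ch. I §2 Prop. 2.3; Huybrechts, *Lectures on K3 Surfaces* (2016), Ch. 3
Lemma 3.1, Ch. 6 Prop. 1.5 and Rem. 3.3; Lang, *Algebra* (2002), Ch. XIV §2–§3, XV §6–§7, XVI §4; van
Geemen–Schütt, Forum Math. Sigma 13 (2025) e2, §2.1, §3.4; Buskin, J. reine angew. Math. 755 (2019), §6.2.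
-/

set_option linter.dupNamespace false

noncomputable section

namespace Summit.HodgeConjecture.HodgeConjecture.Theorems.MarkmanPartnerTransport.RMTypeOrbit

open Polynomial
open Literature.AlgebraicGeometry.Surfaces Literature.LinearAlgebra.QuadraticForm
open Summit.HodgeConjecture.HodgeConjecture.Theorems.MarkmanPartnerTransport.RMTypeDescent

/-! ### §6 Transitivity: reflections along real eigenvectors move one period of the Hodge locus to a
positive multiple of any other -/

section Transitivity

variable {K : Type*} [Field K] {V : Type*} [AddCommGroup V] [Module K V]

/-- **Iversen, Prop. 2.3, with the reflecting vectors named**: if `⟨e,e⟩ = ⟨f,f⟩ ≠ 0` then a product of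
at most two reflections along non-isotropic vectors AMONG `e − f`, `f`, `e + f` maps `e` to `f`.
(Proof adapted from `Literature.LinearAlgebra.QuadraticForm.exists_reflections_apply_eq`, recording the
vectors.) [cite: Iversen1992, Ch. I §2 Prop. 2.3] -/
theorem exists_reflections_apply_eq_mem [NeZero (2 : K)] (B : LinearMap.BilinForm K V) (hB : B.IsSymm)
    {e f : V} (hef : B e e = B f f) (hf : B f f ≠ 0) :
    ∃ l : List V, (∀ n ∈ l, B n n ≠ 0 ∧ (n = e - f ∨ n = f ∨ n = e + f)) ∧
      (l.map (reflection B)).prod e = f := by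
  have hfe : B f e = B e f := hB.eq f e
  by_cases hm : B (e - f) (e - f) = 0
  · have hp : B (e + f) (e + f) ≠ 0 := by
      intro hp
      have h1 : B (e - f) (e - f) = B e e - 2 * B e f + B f f := by
        simp only [map_sub, LinearMap.sub_apply, hfe]; ring
      have h2 : B (e + f) (e + f) = B e e + 2 * B e f + B f f := by
        simp only [map_add, LinearMap.add_apply, hfe]; ring
      have h1' : B e e - 2 * B e f + B f f = 0 := h1.symm.trans hm
      have h2' : B e e + 2 * B e f + B f f = 0 := h2.symm.trans hp
      have h3 : (2 * 2 : K) * B f f = 0 := by linear_combination h1' + h2' - 2 * hef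
      exact (mul_ne_zero (mul_ne_zero (NeZero.ne 2) (NeZero.ne 2)) hf) h3
    refine ⟨[f, e + f], ?_, ?_⟩
    · intro n hn
      simp only [List.mem_cons, List.not_mem_nil, or_false] at hn
      rcases hn with rfl | rfl
      · exact ⟨hf, Or.inr (Or.inl rfl)⟩
      · exact ⟨hp, Or.inr (Or.inr rfl)⟩
    · have hc : 2 / B (e + f) (e + f) * B (e + f) e = 1 := by
        have h2 : B (e + f) (e + f) = 2 * B (e + f) e := by
          simp only [map_add, LinearMap.add_apply, hfe]
          linear_combination hef.symm
        have hne : B (e + f) e ≠ 0 := fun h0 => hp (by rw [h2, h0, mul_zero])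
        rw [h2]
        field_simp
      rw [List.map_cons, List.map_cons, List.map_nil, List.prod_cons, List.prod_cons, List.prod_nil,
        mul_one, Module.End.mul_apply, reflection_apply B (e + f) e, hc, one_smul,
        show e - (e + f) = -f by abel, map_neg, reflection_apply_self B hf, neg_neg]
  · refine ⟨[e - f], ?_, ?_⟩
    · intro n hn
      simp only [List.mem_cons, List.not_mem_nil, or_false] at hn
      rcases hn with rfl
      exact ⟨hm, Or.inl rfl⟩
    · have hc : 2 / B (e - f) (e - f) * B (e - f) e = 1 := by
        have h2 : B (e - f) (e - f) = 2 * B (e - f) e := by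
          simp only [map_sub, LinearMap.sub_apply, hfe]
          linear_combination hef.symm
        have hne : B (e - f) e ≠ 0 := fun h0 => hm (by rw [h2, h0, mul_zero])
        rw [h2]
        field_simp
      rw [List.map_cons, List.map_nil, List.prod_cons, List.prod_nil, mul_one,
        reflection_apply B (e - f) e, hc, one_smul, sub_sub_cancel]

end Transitivity

section K3Transitivity

variable {θ : Matrix K3Index K3Index ℚ}

/-- The real part of a vector of `Λ_ℂ`, as a vector of `Λ_ℂ`. [cite: Huybrechts2016K3, Ch. 6 Prop. 1.5 (proof)] -/
def reV (y : K3Index → ℂ) : K3Index → ℂ := fun i => ((y i).re : ℂ)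

/-- The imaginary part of a vector of `Λ_ℂ`, as a vector of `Λ_ℂ`. [cite: Huybrechts2016K3, Ch. 6 Prop. 1.5 (proof)] -/
def imV (y : K3Index → ℂ) : K3Index → ℂ := fun i => ((y i).im : ℂ)

/-- `y = Re y + i Im y`. [cite: Huybrechts2016K3, Ch. 6 Prop. 1.5 (proof)] -/
theorem reV_add_I_smul_imV (y : K3Index → ℂ) : reV y + Complex.I • imV y = y := by
  funext i
  apply Complex.ext <;> simp [reV, imV]

/-- `Re y = (y + ȳ)/2`. [cite: Huybrechts2016K3, Ch. 6 Prop. 1.5 (proof)] -/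
theorem reV_eq (y : K3Index → ℂ) : reV y = (2⁻¹ : ℂ) • (y + star y) := by
  funext i
  apply Complex.ext
  · simp [reV]; ring
  · simp [reV]

/-- `Im y = −i (y − ȳ)/2`. [cite: Huybrechts2016K3, Ch. 6 Prop. 1.5 (proof)] -/
theorem imV_eq (y : K3Index → ℂ) : imV y = (-(Complex.I * 2⁻¹) : ℂ) • (y - star y) := by
  funext i
  apply Complex.ext
  · simp [imV]; ring
  · simp [imV]

/-- `Re y` is real. [cite: Huybrechts2016K3, Ch. 6 Prop. 1.5 (proof)] -/
theorem star_reV (y : K3Index → ℂ) : star (reV y) = reV y := by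
  funext i; simp [reV]

/-- `(Re y . Re y)` as the real double sum. [cite: Huybrechts2016K3, Ch. 6 Prop. 1.5 (proof)] -/
theorem k3Form_reV_reV (y : K3Index → ℂ) :
    k3Form (reV y) (reV y) = ((∑ i, ∑ j, (y i).re * k3Gram i j * (y j).re : ℝ) : ℂ) := k3Form_ofReal _ _

/-- `(Im y . Im y)` as the real double sum. [cite: Huybrechts2016K3, Ch. 6 Prop. 1.5 (proof)] -/
theorem k3Form_imV_imV (y : K3Index → ℂ) :
    k3Form (imV y) (imV y) = ((∑ i, ∑ j, (y i).im * k3Gram i j * (y j).im : ℝ) : ℂ) := k3Form_ofReal _ _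

/-- `(Re y . Im y)` as the real double sum. [cite: Huybrechts2016K3, Ch. 6 Prop. 1.5 (proof)] -/
theorem k3Form_reV_imV (y : K3Index → ℂ) :
    k3Form (reV y) (imV y) = ((∑ i, ∑ j, (y i).re * k3Gram i j * (y j).im : ℝ) : ℂ) := k3Form_ofReal _ _


/-- `Im y` is real. [cite: Huybrechts2016K3, Ch. 6 Prop. 1.5 (proof)] -/
theorem star_imV (y : K3Index → ℂ) : star (imV y) = imV y := by
  funext i; simp [imV]

/-- A real vector is the cast of its real part. [folklore] -/
theorem reV_eq_self_of_star_eq {n : K3Index → ℂ} (hn : star n = n) : reV n = n := by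
  funext i
  have h := congrFun hn i
  simp only [Pi.star_apply, Complex.star_def] at h
  exact Complex.conj_eq_iff_re.1 h

/-- `θ_ℂ` is a real operator. [cite: Huybrechts2016K3, Ch. 6 §1.1] -/
theorem thetaC_star (θ : Matrix K3Index K3Index ℚ) (y : K3Index → ℂ) :
    thetaC θ (star y) = star (thetaC θ y) := by
  funext i
  simp only [thetaC, Matrix.toLin'_apply, Matrix.mulVec, dotProduct, Matrix.map_apply, Pi.star_apply,
    star_sum, star_mul', eq_ratCast, Complex.star_def, map_ratCast]

/-- For a real eigenvalue, the real part of an eigenvector of the real operator `θ_ℂ` is an eigenvector. [folklore] -/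
theorem thetaC_reV_of_eigen {e : ℂ} (he : star e = e) {y : K3Index → ℂ} (hy : thetaC θ y = e • y) :
    thetaC θ (reV y) = e • reV y := by
  rw [reV_eq, map_smul, map_add, thetaC_star, hy, star_smul, he, ← smul_add, smul_comm]

/-- For a real eigenvalue, the imaginary part of an eigenvector of the real operator `θ_ℂ` is an eigenvector. [folklore] -/
theorem thetaC_imV_of_eigen {e : ℂ} (he : star e = e) {y : K3Index → ℂ} (hy : thetaC θ y = e • y) :
    thetaC θ (imV y) = e • imV y := by
  rw [imV_eq, map_smul, map_sub, thetaC_star, hy, star_smul, he, ← smul_sub, smul_comm]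

/-- Reflections along real vectors are real operators. [cite: Huybrechts2016K3, Ch. 6 §1.1] -/
theorem star_reflection_apply {n : K3Index → ℂ} (hn : star n = n) (x : K3Index → ℂ) :
    star (reflection k3FormC n x) = reflection k3FormC n (star x) := by
  rw [reflection_apply, reflection_apply, k3FormC_apply, k3FormC_apply, k3FormC_apply, star_sub,
    star_smul, hn, star_mul', star_div₀, star_k3Form, star_k3Form, hn, star_ofNat]

/-- A word in reflections along real vectors is a real operator. [cite: Huybrechts2016K3, Ch. 6 §1.1] -/
theorem star_prod_reflections_apply {l : List (K3Index → ℂ)} (hl : ∀ n ∈ l, star n = n)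
    (x : K3Index → ℂ) :
    star ((l.map (reflection k3FormC)).prod x) = (l.map (reflection k3FormC)).prod (star x) := by
  induction l with
  | nil => simp
  | cons n l ih =>
    rw [List.map_cons, List.prod_cons, Module.End.mul_apply, Module.End.mul_apply,
      star_reflection_apply (hl n List.mem_cons_self), ih fun m hm => hl m (List.mem_cons_of_mem n hm)]

/-- Reflections along `e`-eigenvectors of `θ_ℂ` preserve the `e`-eigenspace. [folklore] -/
theorem reflection_eigen {e : ℂ} {n x : K3Index → ℂ} (hn : thetaC θ n = e • n) (hx : thetaC θ x = e • x) :
    thetaC θ (reflection k3FormC n x) = e • reflection k3FormC n x := by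
  rw [reflection_apply, map_sub, map_smul, hn, hx, smul_sub, smul_comm]

/-- A word in reflections along `e`-eigenvectors preserves the `e`-eigenspace. [folklore] -/
theorem prod_reflections_eigen {e : ℂ} {l : List (K3Index → ℂ)} (hl : ∀ n ∈ l, thetaC θ n = e • n)
    {x : K3Index → ℂ} (hx : thetaC θ x = e • x) :
    thetaC θ ((l.map (reflection k3FormC)).prod x) = e • (l.map (reflection k3FormC)).prod x := by
  induction l with
  | nil => simpa using hx
  | cons n l ih =>
    rw [List.map_cons, List.prod_cons, Module.End.mul_apply]
    exact reflection_eigen (hl n List.mem_cons_self) (ih fun m hm => hl m (List.mem_cons_of_mem n hm))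

/-- A product of `k3FormC`-reflections is a `k3Form`-isometry. [cite: Iversen1992, Ch. I §2] -/
theorem k3Form_prod_reflections (l : List (K3Index → ℂ)) (a b : K3Index → ℂ) :
    k3Form ((l.map (reflection k3FormC)).prod a) ((l.map (reflection k3FormC)).prod b) = k3Form a b := by
  have h := isOrthogonal_prod_reflections k3FormC_isSymm l a b
  rwa [k3FormC_apply, k3FormC_apply] at h

/-- **Transitivity on the Hodge locus `D_{θ,e}` by reflections along real `e`-eigenvectors**: for two
period points `y₀, y₁` of `D_{θ,e}` (`θ_ℂ y = e y`, `(y.y) = 0`, `(ȳ.y) > 0`; `e` real) there are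
non-isotropic REAL `e`-eigenvectors `n₁, …, n_k` (`k ≤ 4`) and `r > 0` with
`s_{n_k} ⋯ s_{n_1} y₀ = r·y₁` (frame transport `(Re y₀, Im y₀) ↦ r·(Re y₁, Im y₁)` by Iversen's
Prop. 2.3 twice, the second time inside `(r Re y₁)^⊥`). [cite: Iversen1992, Ch. I §2 Prop. 2.3]
[cite: Huybrechts2016K3, Ch. 6 Prop. 1.5 (proof)] -/
theorem exists_reflections_prod_eq_smul {e : ℂ} (he : star e = e) {y₀ y₁ : K3Index → ℂ}
    (h₀ : thetaC θ y₀ = e • y₀) (h₀₀ : k3Form y₀ y₀ = 0) (h₀p : 0 < (k3Form (star y₀) y₀).re)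
    (h₁ : thetaC θ y₁ = e • y₁) (h₁₁ : k3Form y₁ y₁ = 0) (h₁p : 0 < (k3Form (star y₁) y₁).re) :
    ∃ (l : List (K3Index → ℂ)) (r : ℝ), 0 < r ∧
      (∀ n ∈ l, k3Form n n ≠ 0 ∧ star n = n ∧ thetaC θ n = e • n) ∧
      (l.map (reflection k3FormC)).prod y₀ = (r : ℂ) • y₁ := by
  obtain ⟨hC₀, hAB₀, hA₀⟩ := k3Period_re_im h₀₀ h₀p
  obtain ⟨hC₁, hAB₁, hA₁⟩ := k3Period_re_im h₁₁ h₁p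
  set c₀ : ℝ := ∑ i, ∑ j, (y₀ i).re * k3Gram i j * (y₀ j).re with hc₀
  set c₁ : ℝ := ∑ i, ∑ j, (y₁ i).re * k3Gram i j * (y₁ j).re with hc₁
  set r : ℝ := Real.sqrt (c₀ / c₁) with hr
  have hr0 : 0 < r := Real.sqrt_pos.2 (div_pos hA₀ hA₁)
  have hr2 : r ^ 2 * c₁ = c₀ := by
    rw [hr, Real.sq_sqrt (div_pos hA₀ hA₁).le, div_mul_cancel₀ _ hA₁.ne']
  set e₁ := reV y₀ with he₁
  set e₂ := imV y₀ with he₂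
  set f₁ := (r : ℂ) • reV y₁ with hf₁
  set f₂ := (r : ℂ) • imV y₁ with hf₂
  -- Gram data
  have hE₁ : k3Form e₁ e₁ = (c₀ : ℂ) := k3Form_reV_reV y₀
  have hE₂ : k3Form e₂ e₂ = (c₀ : ℂ) := by rw [he₂, k3Form_imV_imV, ← hAB₀]
  have hE₁₂ : k3Form e₁ e₂ = 0 := by rw [he₁, he₂, k3Form_reV_imV, hC₀, Complex.ofReal_zero]
  have hF₁ : k3Form f₁ f₁ = (c₀ : ℂ) := by
    rw [hf₁, k3Form_smul_left, k3Form_smul_right, k3Form_reV_reV, ← hc₁, ← hr2]; push_cast; ring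
  have hF₂ : k3Form f₂ f₂ = (c₀ : ℂ) := by
    rw [hf₂, k3Form_smul_left, k3Form_smul_right, k3Form_imV_imV, ← hAB₁, ← hr2]; push_cast; ring
  have hF₁₂ : k3Form f₁ f₂ = 0 := by
    rw [hf₁, hf₂, k3Form_smul_left, k3Form_smul_right, k3Form_reV_imV, hC₁]; simp
  have hc₀ne : (c₀ : ℂ) ≠ 0 := by exact_mod_cast hA₀.ne'
  -- reality and eigen data of the frames
  have hre₁ : star e₁ = e₁ := star_reV y₀
  have hre₂ : star e₂ = e₂ := star_imV y₀
  have hrr : star (r : ℂ) = r := Complex.conj_ofReal r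
  have hrf₁ : star f₁ = f₁ := by rw [hf₁, star_smul, hrr, star_reV]
  have hrf₂ : star f₂ = f₂ := by rw [hf₂, star_smul, hrr, star_imV]
  have hte₁ : thetaC θ e₁ = e • e₁ := thetaC_reV_of_eigen he h₀
  have hte₂ : thetaC θ e₂ = e • e₂ := thetaC_imV_of_eigen he h₀
  have htf₁ : thetaC θ f₁ = e • f₁ := by rw [hf₁, map_smul, thetaC_reV_of_eigen he h₁, smul_comm]
  have htf₂ : thetaC θ f₂ = e • f₂ := by rw [hf₂, map_smul, thetaC_imV_of_eigen he h₁, smul_comm]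
  -- step 1: `e₁ ↦ f₁`
  obtain ⟨l₁, hl₁, hg₁e₁⟩ := exists_reflections_apply_eq_mem k3FormC k3FormC_isSymm (e := e₁) (f := f₁)
    (by rw [k3FormC_apply, k3FormC_apply, hE₁, hF₁]) (by rw [k3FormC_apply, hF₁]; exact hc₀ne)
  have hl₁real : ∀ n ∈ l₁, star n = n := by
    intro n hn
    rcases (hl₁ n hn).2 with rfl | rfl | rfl
    · rw [star_sub, hre₁, hrf₁]
    · exact hrf₁
    · rw [star_add, hre₁, hrf₁]
  have hl₁eig : ∀ n ∈ l₁, thetaC θ n = e • n := by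
    intro n hn
    rcases (hl₁ n hn).2 with rfl | rfl | rfl
    · rw [map_sub, hte₁, htf₁, smul_sub]
    · exact htf₁
    · rw [map_add, hte₁, htf₁, smul_add]
  set g₁ := (l₁.map (reflection k3FormC)).prod with hg₁
  set e₂' := g₁ e₂ with he₂'
  have hE₂' : k3Form e₂' e₂' = (c₀ : ℂ) := by rw [he₂', hg₁, k3Form_prod_reflections, hE₂]
  have hF₁E₂' : k3Form f₁ e₂' = 0 := by rw [← hg₁e₁, he₂', hg₁, k3Form_prod_reflections, hE₁₂]
  have hre₂' : star e₂' = e₂' := by rw [he₂', hg₁, star_prod_reflections_apply hl₁real, hre₂]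
  have hte₂' : thetaC θ e₂' = e • e₂' := by rw [he₂', hg₁]; exact prod_reflections_eigen hl₁eig hte₂
  -- step 2: `e₂' ↦ f₂` inside `f₁^⊥`
  obtain ⟨l₂, hl₂, hg₂e₂'⟩ := exists_reflections_apply_eq_mem k3FormC k3FormC_isSymm (e := e₂') (f := f₂)
    (by rw [k3FormC_apply, k3FormC_apply, hE₂', hF₂]) (by rw [k3FormC_apply, hF₂]; exact hc₀ne)
  have hl₂f₁ : ∀ n ∈ l₂, k3FormC n f₁ = 0 := by
    intro n hn
    rw [k3FormC_apply]
    rcases (hl₂ n hn).2 with rfl | rfl | rfl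
    · rw [NikulinTwinTransport.k3Form_sub_left, k3Form_comm, hF₁E₂', k3Form_comm, hF₁₂, sub_zero]
    · rw [k3Form_comm, hF₁₂]
    · rw [k3Form_add_left, k3Form_comm, hF₁E₂', k3Form_comm, hF₁₂, add_zero]
  have hl₂real : ∀ n ∈ l₂, star n = n := by
    intro n hn
    rcases (hl₂ n hn).2 with rfl | rfl | rfl
    · rw [star_sub, hre₂', hrf₂]
    · exact hrf₂
    · rw [star_add, hre₂', hrf₂]
  have hl₂eig : ∀ n ∈ l₂, thetaC θ n = e • n := by
    intro n hn
    rcases (hl₂ n hn).2 with rfl | rfl | rfl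
    · rw [map_sub, hte₂', htf₂, smul_sub]
    · exact htf₂
    · rw [map_add, hte₂', htf₂, smul_add]
  set g₂ := (l₂.map (reflection k3FormC)).prod with hg₂
  have hg₂f₁ : g₂ f₁ = f₁ := prod_reflections_apply_of_forall_ortho hl₂f₁
  refine ⟨l₂ ++ l₁, r, hr0, ?_, ?_⟩
  · intro n hn
    rcases List.mem_append.1 hn with hn | hn
    · exact ⟨by have := (hl₂ n hn).1; rwa [k3FormC_apply] at this, hl₂real n hn, hl₂eig n hn⟩
    · exact ⟨by have := (hl₁ n hn).1; rwa [k3FormC_apply] at this, hl₁real n hn, hl₁eig n hn⟩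
  · have h1 : g₁ y₀ = f₁ + Complex.I • e₂' := by
      conv_lhs => rw [← reV_add_I_smul_imV y₀]
      rw [map_add, map_smul, ← he₁, ← he₂, hg₁e₁]
    have h2 : g₂ (f₁ + Complex.I • e₂') = f₁ + Complex.I • f₂ := by
      rw [map_add, hg₂f₁, map_smul, hg₂e₂']
    rw [List.map_append, List.prod_append, Module.End.mul_apply, ← hg₁, ← hg₂, h1, h2, hf₁, hf₂,
      smul_comm Complex.I (r : ℂ), ← smul_add, reV_add_I_smul_imV]

end K3Transitivity

end Summit.HodgeConjecture.HodgeConjecture.Theorems.MarkmanPartnerTransport.RMTypeOrbit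

end
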